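import Summits.QuantumFields.BalabanUV.Beta.GAN24.MinimiserOneStepDecay
import Summits.QuantumFields.BalabanUV.Beta.GAN24.ScalarSup110G

/-!
# G-an2-4 ∕ (CONV-C), road P2 — THE ZEROTH LETTER (L0) OF THE SCALAR PROPAGATOR `𝒢′ = (Δ + a′Π′)⁻¹` ON EVERY TORUS, IN ROAD P2's
# CURRENCIES, UNCONDITIONAL: `RowDecay` (per-block rows `≤ C·e^{−δ₀|y−y′|}`), the global sup → sup letter `‖𝒢′f‖_∞ ≤ C₀‖f‖_∞`, and
# the soft minimiser's bound `‖Mw‖_∞ ≤ a′C₀‖w‖_∞` — from leaf-01 gen 55's `ScalarSup110G.gps_block_row_sum_le`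

Unit `b2b-balaban-gan24-p2` (gen 29), BINDER row G-an2-4 ∕ (CONV-C), road P2.  The G-an2-4 swarm answered this seat's «INTERFACE REQUEST G-an2-4:
(SCALAR-LETTERS for `Gps`)» item (L0) = (s0) for EVERY torus and every `a′ > 0` (leaf-01 gen 55: `ScalarFreeResolvent*`, `ScalarSup110GWeight`,
`ScalarSup110GPieces`, `ScalarSup110G`).  THIS FILE converts it BY NAME into the binders of road P2's files:
 * **`rowDecay_Gps`** — `∃ δ₀ C > 0, ∀ n M, RowDecay M (blockOf n M) (blockOf n M) (Gps n M a′) C δ₀` (`MinimiserOneStepDecay.rowDecay_of_bpt_row_sum`):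
   the binder `hC₀` of `MinimiserOneStepDecay.fieldDecay_Mhard_succ_sub_stair`, DISCHARGED on every torus;
 * **`sup_Gps`** — `∃ C₀ > 0, ∀ n M f b, ‖f‖_∞ ≤ b → ‖(𝒢′f)(x)‖ ≤ C₀·b` (`norm_mulVec_le_of_rowDecay`; `C₀ = max(C·K_{d+1}(δ₀), 1)`): the binder
   `hC₀` of `HardMinimiserOneStepSup.norm_Mhard_succ_sub_stair_le_of_letters`, DISCHARGED on every torus;
 * **`sup_Msoft`** — `‖(Mw)(x)‖ ≤ a′·C₀·‖w‖_∞` for the soft minimiser `M = a′𝒢′Q′*` (`HardMinimiserOneStepSup.msoft_letter`).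
HONEST SCOPE.  Junction only; [folklore]; the analysis is leaf-01 gen 55's (constants existential in `(d, a′)`, n- and volume-uniform); scalar,
`U = 1`.  NOT (CONV-C), NEVER «G-an2-4 closed», NOT NE2, NOT D1, NOT BetaPertH, NOT continuum, NOT Clay; not in print — our proof.  HONEST
DEPENDENCY: continuum YM on T⁴ ⇐ BetaPertH ∧ nine spine estimates (0/9 proved); BetaPertH ⇐ (D1) ∧ (D4) ∧ CAP+tail; G-an2-4 gates asym, D1 and
NE2/3/4.
-/

noncomputable section

open scoped BigOperators ComplexConjugate Matrix

namespace Summit.QuantumFields.BalabanUV.Beta.GAN24.ScalarZerothLetterTorus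

open Literature.MathematicalPhysics.QuantumFieldTheory.Balaban1983to89
open B5Prop11Plancherel (Tor fine)
open B5Blocks16 (blockOf)
open B4Sect5Proof (latticeConst)
open Summit.QuantumFields.BalabanUV.T4Continuum.ScalarAveragedPropagator (Gps)
open Summit.QuantumFields.BalabanUV.Beta.GAN24.SoftMinimiserOneStepSup (Msoft)
open Summit.QuantumFields.BalabanUV.Beta.GAN24.HardMinimiserOneStepSup (msoft_letter)
open Summit.QuantumFields.BalabanUV.Beta.GAN24.BlockFieldDecay (RowDecay)
open Summit.QuantumFields.BalabanUV.Beta.GAN24.MinimiserOneStepDecay (rowDecay_of_bpt_row_sum norm_mulVec_le_of_rowDecay)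
open Summit.QuantumFields.BalabanUV.Beta.GAN24.ScalarSup110G (gps_block_row_sum_le)

variable (d : ℕ)

/-- **(L0) in `RowDecay` form, EVERY torus, every `a′ > 0`, UNCONDITIONAL.** [folklore] -/
theorem rowDecay_Gps {a' : ℝ} (ha' : 0 < a') :
    ∃ δ₀ C : ℝ, 0 < δ₀ ∧ 0 < C ∧ ∀ (n : ℕ) [NeZero n] (M : Fin (d + 1) → ℕ) [∀ μ, NeZero (M μ)],
      RowDecay M (blockOf n M) (blockOf n M) (Gps n M a') C δ₀ := by
  obtain ⟨δ₀, C, hδ₀, hC, h⟩ := gps_block_row_sum_le d ha'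
  exact ⟨δ₀, C, hδ₀, hC, fun n _ M _ => rowDecay_of_bpt_row_sum (M := M) n (Gps n M a') (fun x x' r => h n M x x' r)⟩

/-- **(L0) as a global sup → sup letter, EVERY torus, UNCONDITIONAL**: `∃ C₀ > 0, ∀ n M f b, ‖f‖_∞ ≤ b → ‖(𝒢′f)(x)‖ ≤ C₀·b`. [folklore] -/
theorem sup_Gps {a' : ℝ} (ha' : 0 < a') :
    ∃ C₀ : ℝ, 0 < C₀ ∧ ∀ (n : ℕ) [NeZero n] (M : Fin (d + 1) → ℕ) [∀ μ, NeZero (M μ)]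
      (f : Tor (fine n M) → ℂ) (b : ℝ), (∀ y, ‖f y‖ ≤ b) → ∀ x, ‖(Gps n M a' *ᵥ f) x‖ ≤ C₀ * b := by
  obtain ⟨δ₀, C, hδ₀, _, h⟩ := rowDecay_Gps d ha'
  refine ⟨max (C * latticeConst (d + 1) δ₀) 1, lt_max_of_lt_right one_pos, fun n _ M _ f b hf x => ?_⟩
  have hb : 0 ≤ b := (norm_nonneg _).trans (hf 0)
  exact (norm_mulVec_le_of_rowDecay (M := M) n (Gps n M a') (h n M) hδ₀ f b hf x).trans
    (mul_le_mul_of_nonneg_right (le_max_left _ _) hb)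

/-- **the soft minimiser is sup-bounded, EVERY torus, UNCONDITIONAL**: `‖(Mw)(x)‖ ≤ a′·C₀·b` for `‖w‖_∞ ≤ b`. [folklore] -/
theorem sup_Msoft {a' : ℝ} (ha' : 0 < a') :
    ∃ C₀ : ℝ, 0 < C₀ ∧ ∀ (n : ℕ) [NeZero n] (M : Fin (d + 1) → ℕ) [∀ μ, NeZero (M μ)]
      (w : Tor M → ℂ) (b : ℝ), (∀ y, ‖w y‖ ≤ b) → ∀ x, ‖(Msoft n M a' *ᵥ w) x‖ ≤ a' * C₀ * b := by
  obtain ⟨C₀, hC₀, h⟩ := sup_Gps d ha'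
  exact ⟨C₀, hC₀, fun n _ M _ w b hw x => msoft_letter n M ha' (h n M) w b hw x⟩

end Summit.QuantumFields.BalabanUV.Beta.GAN24.ScalarZerothLetterTorus

end
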